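import Mathlib.Algebra.BigOperators.Ring.Finset
import Mathlib.Algebra.Order.BigOperators.Group.List
import Mathlib.Algebra.Order.Ring.Abs
import Mathlib.Tactic.Ring
import Mathlib.Tactic.Linarith
import Mathlib.Tactic.NormNum
import Mathlib.Tactic.Positivity
import Literature.NumberTheory.EllipticCurves.KleinFrickeSevenCertificateB
import HarnessLib

/-!
# Klein–Fricke at level 7 — the two certificates re-checked BY THE KERNEL (no `native_decide`)

The level-`7` Klein–Fricke theorem of `KleinFrickeLevelSeven.lean` rests on two polynomial
identities `Γ₇(U7, V7) = q7 · Φ₇` and `Γ₇(U7b, V7b) = q7b · Φ₇` in `ℤ[a, b, x]` (degree `192`,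
cofactors of 2605 monomials), certified in `KleinFrickeSevenCertificate(B).lean` by
`native_decide` (`gamma7_cert`, `gamma7b_cert`: the sparse normal form `PolyCert.normalize`
sorts by well-founded recursion, which the kernel does not evaluate), making the whole
Klein–Fricke-`7` chain `computational` (`Lean.ofReduceBool`). This file proves the SAME two
evaluated identities (`eval_gamma7Of_eq_kernel`, `eval_gamma7bOf_eq_kernel`, with exactly the
statements produced by `PolyCert.eval_eq_of_isZero_sub _ _ _ gamma7_cert` resp. `gamma7b_cert`)
from a certificate the KERNEL checks in a few seconds, so that the two uses in
`klein_seven_core` can be replaced and the chain becomes axiom-clean.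

## Method: Kronecker evaluation + balanced-digit injectivity

All four data polynomials are weighted-homogeneous (`x : 2`, `a : 4`, `b : 6`; `U7, V7, Φ₇` of
weight `48`, `q7` of weight `348`), hence so is the difference
`D = Γ₇ʳᵃʷ(U7, V7) − q7 ·ʳᵃʷ Φ₇` (weight `396`), built here with UNNORMALISED list operations
only (`mulRaw`, `++`, `smul`; never evaluated). For such a list `D`:

* (`PolyCert.eval_eq_zero_of_evalK_eq_zero`) if every monomial has `a`-exponent `< M`, the sum
  of the absolute values of the coefficients is `< T`, and the INTEGER
  `evalK T M D = Σ c · T^(i + M j)` (the value of `D` at `a = T`, `b = T^M`, `x = 1`) vanishes, then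
  `D` evaluates to `0` in every commutative ring: grouping the monomials by `n = i + M j`
  (which, with the weight, determines `(i, j, k)`), the collected coefficients `s n` satisfy
  `Σ s n · Tⁿ = 0` and `|s n| < T`, so all vanish (uniqueness of balanced base-`T` digits);
* `evalK` is a ring homomorphism on raw lists (it IS `PolyCert.eval` at `(T, T^M, 1)`), so
  `evalK T M D` is an explicit integer expression in the four numbers `evalK T M U7`, …, each a
  61- or 2605-term sum of `c · T^(i + M j)` computed by the kernel with its accelerated `Nat.pow`
  (`T = 2^300`, `M = 128`; `decide +kernel`, seconds) — `gamma7_evalK_cert`, `gamma7b_evalK_cert`;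
* the side conditions (homogeneity, `i < 128`, coefficient bound `< 2^300`, the latter from the
  multiplicativity `l1 (mulRaw p q) ≤ l1 p * l1 q` and the computed `l1` of the data) are
  structural lemmas plus small kernel computations.
-/

namespace Literature.NumberTheory.EllipticCurves.PolyCert

open Finset

variable {R : Type*} [CommRing R]

/-! ### Raw (unnormalised) composite operations -/

/-- Power by repeated UNNORMALISED multiplication. [folklore] -/
def powRaw (p : SPoly) : ℕ → SPoly
  | 0 => [⟨0, 0, 0, 1⟩]
  | n + 1 => mulRaw (powRaw p n) p

/-- `eval (powRaw p n) = (eval p)^n`. [folklore] -/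
@[simp] theorem eval_powRaw (a b x : R) (p : SPoly) (n : ℕ) :
    eval a b x (powRaw p n) = eval a b x p ^ n := by
  induction n with
  | zero => simp [powRaw, eval, Mono.eval]
  | succ n ih => rw [powRaw, eval_mulRaw, ih, pow_succ]

/-- `Γ₇(U, V)` built from UNNORMALISED operations (same shape as `gamma7Of`). [folklore] -/
def gamma7OfRaw (U V : SPoly) : SPoly :=
  sub (smul 6912 (mulRaw (powRaw va 3) (mulRaw U (powRaw V 7))))
    (mulRaw (add (smul 4 (powRaw va 3)) (smul 27 (powRaw vb 2)))
      (mulRaw (add (add (mulRaw U U) (smul 13 (mulRaw U V))) (smul 49 (mulRaw V V)))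
        (powRaw (add (add (mulRaw U U) (smul 5 (mulRaw U V))) (mulRaw V V)) 3)))

/-- Evaluation of `gamma7OfRaw` (the same value as `eval_gamma7Of`). [folklore] -/
theorem eval_gamma7OfRaw (a b x : R) (U V : SPoly) :
    eval a b x (gamma7OfRaw U V) =
      6912 * a ^ 3 * eval a b x U * eval a b x V ^ 7 -
        (4 * a ^ 3 + 27 * b ^ 2) *
          ((eval a b x U ^ 2 + 13 * (eval a b x U * eval a b x V) + 49 * eval a b x V ^ 2) *
            (eval a b x U ^ 2 + 5 * (eval a b x U * eval a b x V) + eval a b x V ^ 2) ^ 3) := by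
  simp only [gamma7OfRaw, eval_sub, eval_smul, eval_mulRaw, eval_powRaw, eval_add, eval_va,
    eval_vb]
  push_cast
  ring

/-! ### Weight, `a`-exponent bound, coefficient norm -/

/-- Weight of a monomial for `x : 2`, `a : 4`, `b : 6` (the short-Weierstrass grading). [folklore] -/
def Mono.wt (m : Mono) : ℕ := 4 * m.i + 6 * m.j + 2 * m.k

/-- All monomials of `p` have weight `W`. [folklore] -/
def Homog (W : ℕ) (p : SPoly) : Prop := ∀ m ∈ p, m.wt = W

/-- All monomials of `p` have `a`-exponent `≤ B`. [folklore] -/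
def IBd (B : ℕ) (p : SPoly) : Prop := ∀ m ∈ p, m.i ≤ B

/-- Sum of the absolute values of the coefficients. [folklore] -/
def l1 (p : SPoly) : ℕ := (p.map fun m => m.c.natAbs).sum

/-- `Homog W p` is decidable (a finite conjunction over the list). [folklore] -/
instance (W : ℕ) (p : SPoly) : Decidable (Homog W p) := by unfold Homog; infer_instance

/-- `IBd B p` is decidable (a finite conjunction over the list). [folklore] -/
instance (B : ℕ) (p : SPoly) : Decidable (IBd B p) := by unfold IBd; infer_instance

/-- `Homog` of an append. [folklore] -/
theorem Homog.append {W : ℕ} {p q : SPoly} (hp : Homog W p) (hq : Homog W q) : Homog W (p ++ q) :=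
  fun m hm => (List.mem_append.mp hm).elim (hp m) (hq m)

/-- `Homog` of a scalar multiple. [folklore] -/
theorem Homog.smul {W : ℕ} {p : SPoly} (hp : Homog W p) (c : ℤ) : Homog W (smul c p) := by
  intro m hm
  obtain ⟨m', hm', rfl⟩ := List.mem_map.mp hm
  exact hp m' hm'

/-- `Homog` of `mulMono`. [folklore] -/
theorem Homog.mulMono {W₁ W₂ : ℕ} {m : Mono} (hm : m.wt = W₁) {p : SPoly} (hp : Homog W₂ p) :
    Homog (W₁ + W₂) (mulMono m p) := by
  intro n hn
  obtain ⟨m', hm', rfl⟩ := List.mem_map.mp hn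
  have h2 := hp m' hm'
  simp only [Mono.wt] at hm h2 ⊢
  omega

/-- `Homog` of an unnormalised product: weights add. [folklore] -/
theorem Homog.mulRaw {W₁ W₂ : ℕ} {p q : SPoly} (hp : Homog W₁ p) (hq : Homog W₂ q) :
    Homog (W₁ + W₂) (mulRaw p q) := by
  intro n hn
  obtain ⟨m, hm, hn⟩ := List.mem_flatMap.mp hn
  exact Homog.mulMono (hp m hm) hq n hn

/-- `Homog` of an unnormalised power. [folklore] -/
theorem Homog.powRaw {W : ℕ} {p : SPoly} (hp : Homog W p) : ∀ n : ℕ, Homog (n * W) (powRaw p n)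
  | 0 => by
    intro m hm
    simp only [PolyCert.powRaw, List.mem_singleton] at hm
    subst hm
    simp [Mono.wt]
  | n + 1 => by
    rw [PolyCert.powRaw, Nat.succ_mul]
    exact (Homog.powRaw hp n).mulRaw hp

/-- `IBd` of an append. [folklore] -/
theorem IBd.append {B : ℕ} {p q : SPoly} (hp : IBd B p) (hq : IBd B q) : IBd B (p ++ q) :=
  fun m hm => (List.mem_append.mp hm).elim (hp m) (hq m)

/-- `IBd` is monotone in the bound. [folklore] -/
theorem IBd.mono {B B' : ℕ} (h : B ≤ B') {p : SPoly} (hp : IBd B p) : IBd B' p :=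
  fun m hm => (hp m hm).trans h

/-- `IBd` of a scalar multiple. [folklore] -/
theorem IBd.smul {B : ℕ} {p : SPoly} (hp : IBd B p) (c : ℤ) : IBd B (smul c p) := by
  intro m hm
  obtain ⟨m', hm', rfl⟩ := List.mem_map.mp hm
  exact hp m' hm'

/-- `IBd` of an unnormalised product: bounds add. [folklore] -/
theorem IBd.mulRaw {B₁ B₂ : ℕ} {p q : SPoly} (hp : IBd B₁ p) (hq : IBd B₂ q) :
    IBd (B₁ + B₂) (mulRaw p q) := by
  intro n hn
  obtain ⟨m, hm, hn⟩ := List.mem_flatMap.mp hn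
  obtain ⟨m', hm', rfl⟩ := List.mem_map.mp hn
  exact Nat.add_le_add (hp m hm) (hq m' hm')

/-- `IBd` of an unnormalised power. [folklore] -/
theorem IBd.powRaw {B : ℕ} {p : SPoly} (hp : IBd B p) : ∀ n : ℕ, IBd (n * B) (powRaw p n)
  | 0 => by
    intro m hm
    simp only [PolyCert.powRaw, List.mem_singleton] at hm
    subst hm
    simp
  | n + 1 => by
    rw [PolyCert.powRaw, Nat.succ_mul]
    exact (IBd.powRaw hp n).mulRaw hp

/-- `l1` of an append. [folklore] -/
@[simp] theorem l1_append (p q : SPoly) : l1 (p ++ q) = l1 p + l1 q := by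
  simp [l1, List.map_append, List.sum_append]

/-- `l1` of a scalar multiple. [folklore] -/
@[simp] theorem l1_smul (c : ℤ) (p : SPoly) : l1 (smul c p) = c.natAbs * l1 p := by
  induction p with
  | nil => simp [l1, smul]
  | cons m p ih =>
    simp only [smul, List.map_cons] at ih ⊢
    simp only [l1, List.map_cons, List.sum_cons, Int.natAbs_mul] at ih ⊢
    rw [ih, mul_add]

/-- `l1` of `mulMono`. [folklore] -/
theorem l1_mulMono (m : Mono) (p : SPoly) : l1 (mulMono m p) = m.c.natAbs * l1 p := by
  induction p with
  | nil => simp [l1, mulMono]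
  | cons m' p ih =>
    simp only [mulMono, List.map_cons] at ih ⊢
    simp only [l1, List.map_cons, List.sum_cons, Int.natAbs_mul] at ih ⊢
    rw [ih, mul_add]

/-- `l1` of an unnormalised product is the product of the `l1`. [folklore] -/
@[simp] theorem l1_mulRaw (p q : SPoly) : l1 (mulRaw p q) = l1 p * l1 q := by
  induction p with
  | nil => simp [l1, mulRaw]
  | cons m p ih =>
    simp only [mulRaw, List.flatMap_cons] at ih ⊢
    rw [l1_append, l1_mulMono, ih]
    simp only [l1, List.map_cons, List.sum_cons]
    ring

/-- `l1` of an unnormalised power. [folklore] -/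
@[simp] theorem l1_powRaw (p : SPoly) (n : ℕ) : l1 (powRaw p n) = l1 p ^ n := by
  induction n with
  | zero => simp [powRaw, l1]
  | succ n ih => rw [powRaw, l1_mulRaw, ih, pow_succ]

/-- `l1` of the basic pieces. [folklore] -/
@[simp] theorem l1_va : l1 va = 1 := by decide
/-- `l1 vb = 1`. [folklore] -/
@[simp] theorem l1_vb : l1 vb = 1 := by decide
/-- `l1 (add p q)`. [folklore] -/
@[simp] theorem l1_add (p q : SPoly) : l1 (add p q) = l1 p + l1 q := l1_append p q
/-- `l1 (neg p)`. [folklore] -/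
@[simp] theorem l1_neg (p : SPoly) : l1 (neg p) = l1 p := by simp [neg]
/-- `l1 (sub p q)`. [folklore] -/
@[simp] theorem l1_sub (p q : SPoly) : l1 (sub p q) = l1 p + l1 q := by simp [sub]

/-! ### The Kronecker value `evalK T M p = eval T (T^M) 1 p` and its fast form -/

/-- Kronecker value of a raw list at base `T` with stride `M`: `Σ c · T^(i + M j)` (the `x`-exponent
is dropped), computed with `Nat.pow` (kernel-accelerated). [folklore] -/
def evalK (T M : ℕ) (p : SPoly) : ℤ := (p.map fun m : Mono => m.c * ((T ^ (m.i + M * m.j) : ℕ) : ℤ)).sum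

/-- `evalK` is `eval` at `a = T`, `b = T^M`, `x = 1`. [folklore] -/
theorem eval_kronecker (T M : ℕ) (p : SPoly) : eval (T : ℤ) ((T : ℤ) ^ M) 1 p = evalK T M p := by
  induction p with
  | nil => rfl
  | cons m p ih =>
    have hc : evalK T M (m :: p) = m.c * ((T ^ (m.i + M * m.j) : ℕ) : ℤ) + evalK T M p := by
      simp [evalK]
    rw [eval_cons, ih, hc]
    congr 1
    simp only [Mono.eval, one_pow, mul_one, Int.cast_id]
    push_cast
    ring

/-! ### Injectivity: a bounded homogeneous list with vanishing Kronecker value evaluates to `0` -/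

/-- Regrouping a list sum along the fibres of a key with values in a finite set. [folklore] -/
theorem list_sum_map_eq_sum_fiber {α A : Type*} [AddCommMonoid A] (key : α → ℕ)
    (f : α → A) (S : Finset ℕ) :
    ∀ l : List α, (∀ m ∈ l, key m ∈ S) →
      (l.map f).sum = ∑ n ∈ S, ((l.filter fun m => key m = n).map f).sum
  | [], _ => by simp
  | m :: l, h => by
    have hm : key m ∈ S := h m (by simp)
    have hl : ∀ m' ∈ l, key m' ∈ S := fun m' hm' => h m' (by simp [hm'])
    rw [List.map_cons, List.sum_cons, list_sum_map_eq_sum_fiber key f S l hl]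
    have step : ∀ n ∈ S, (((m :: l).filter fun m' => key m' = n).map f).sum =
        (if key m = n then f m else 0) + ((l.filter fun m' => key m' = n).map f).sum := by
      intro n _
      by_cases hk : key m = n
      · rw [List.filter_cons_of_pos (by simpa using hk), List.map_cons, List.sum_cons, if_pos hk]
      · rw [List.filter_cons_of_neg (by simpa using hk), if_neg hk, zero_add]
    rw [Finset.sum_congr rfl step, Finset.sum_add_distrib, Finset.sum_ite_eq S (key m) (fun _ => f m),
      if_pos hm]

/-- On a fibre of the key, a monomial-wise product with a factor depending only on the key
factors out of the sum of coefficients. [folklore] -/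
theorem sum_fiber_mul {A : Type*} [CommRing A] (key : Mono → ℕ) (g : ℕ → A) (n : ℕ) :
    ∀ l : List Mono, (∀ m ∈ l, key m = n) →
      (l.map fun m => (m.c : A) * g (key m)).sum = ((l.map fun m => m.c).sum : ℤ) * g n
  | [], _ => by simp
  | m :: l, h => by
    have hm : key m = n := h m (by simp)
    have hl : ∀ m' ∈ l, key m' = n := fun m' hm' => h m' (by simp [hm'])
    rw [List.map_cons, List.sum_cons, sum_fiber_mul key g n l hl, List.map_cons, List.sum_cons, hm]
    push_cast
    ring

/-- The absolute value of the sum of the coefficients of a sublist is at most `l1`. [folklore] -/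
theorem natAbs_sum_filter_le (q : Mono → Bool) :
    ∀ l : List Mono, ((l.filter q).map fun m : Mono => m.c).sum.natAbs ≤ l1 l
  | [] => by simp [l1]
  | m :: l => by
    have ih := natAbs_sum_filter_le q l
    simp only [l1, List.map_cons, List.sum_cons] at ih ⊢
    by_cases hq : q m = true
    · rw [List.filter_cons_of_pos hq, List.map_cons, List.sum_cons]
      exact (Int.natAbs_add_le _ _).trans (Nat.add_le_add_left ih _)
    · rw [List.filter_cons_of_neg hq]
      exact ih.trans (Nat.le_add_left _ _)

/-- **Uniqueness of balanced base-`T` digits**: if `Σ_{n<N} s n · Tⁿ = 0` with `|s n| < T` for all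
`n`, then `s n = 0` for all `n < N`. [folklore] -/
theorem digits_eq_zero {T : ℕ} (hT : 0 < T) :
    ∀ (N : ℕ) (s : ℕ → ℤ), (∀ n, (s n).natAbs < T) →
      ∑ n ∈ Finset.range N, s n * (T : ℤ) ^ n = 0 → ∀ n < N, s n = 0
  | 0, _, _, _ => fun n hn => absurd hn (Nat.not_lt_zero n)
  | N + 1, s, hs, hsum => by
    rw [Finset.sum_range_succ'] at hsum
    simp only [pow_zero, mul_one, pow_succ] at hsum
    have hfac : ∑ n ∈ Finset.range N, s (n + 1) * ((T : ℤ) ^ n * T) =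
        T * ∑ n ∈ Finset.range N, s (n + 1) * (T : ℤ) ^ n := by
      rw [Finset.mul_sum]
      exact Finset.sum_congr rfl fun n _ => by ring
    rw [hfac] at hsum
    -- `T ∣ s 0` and `|s 0| < T`, so `s 0 = 0`
    have h0 : s 0 = 0 := by
      have hdvd : (T : ℤ) ∣ s 0 := ⟨-(∑ n ∈ Finset.range N, s (n + 1) * (T : ℤ) ^ n), by linarith⟩
      exact Int.eq_zero_of_dvd_of_natAbs_lt_natAbs hdvd (by simpa using hs 0)
    rw [h0, add_zero] at hsum
    have hrest : ∑ n ∈ Finset.range N, s (n + 1) * (T : ℤ) ^ n = 0 := by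
      rcases mul_eq_zero.mp hsum with h | h
      · exact absurd h (by exact_mod_cast hT.ne')
      · exact h
    have ih := digits_eq_zero hT N (fun n => s (n + 1)) (fun n => hs (n + 1)) hrest
    intro n hn
    rcases n with _ | n
    · exact h0
    · exact ih n (by omega)

/-- **Injectivity of the Kronecker evaluation on bounded homogeneous lists.** Let `p` be a raw
list of monomials, all of weight `W` and with `a`-exponent `< M` (`0 < M`), whose coefficients have
absolute values summing to less than `T`. If its Kronecker value `evalK T M p` vanishes, then `p`
evaluates to `0` at every point of every commutative ring: the monomials with a given
`n = i + M j` share `(i, j) = (n mod M, n / M)` and, by the weight, the same `k`, so `eval p` and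
`evalK p` are the sums over `n` of the collected coefficient `s n` times a monomial resp. `Tⁿ`;
`Σ s n Tⁿ = 0` with `|s n| ≤ l1 p < T` forces every `s n = 0`. [folklore] -/
theorem eval_eq_zero_of_evalK_eq_zero {W M T : ℕ} (hM : 0 < M) {p : SPoly} (hW : Homog W p)
    (hI : ∀ m ∈ p, m.i < M) (hl : l1 p < T) (hK : evalK T M p = 0) (a b x : R) :
    eval a b x p = 0 := by
  classical
  set key : Mono → ℕ := fun m => m.i + M * m.j with hkey
  -- a finite set of keys
  set S : Finset ℕ := (p.map key).toFinset with hS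
  have hmemS : ∀ m ∈ p, key m ∈ S := fun m hm => by
    rw [hS, List.mem_toFinset]; exact List.mem_map.mpr ⟨m, hm, rfl⟩
  obtain ⟨N, hN⟩ : ∃ N, ∀ n ∈ S, n < N :=
    ⟨S.sup id + 1, fun n hn => Nat.lt_succ_of_le (Finset.le_sup (f := id) hn)⟩
  -- collected coefficients
  set s : ℕ → ℤ := fun n => ((p.filter fun m => key m = n).map fun m => m.c).sum with hs
  have hs_abs : ∀ n, (s n).natAbs < T := fun n =>
    (natAbs_sum_filter_le (fun m => decide (key m = n)) p).trans_lt hl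
  have hs_out : ∀ n, n ∉ S → s n = 0 := by
    intro n hn
    have : (p.filter fun m => key m = n) = [] := by
      rw [List.filter_eq_nil_iff]
      intro m hm hk
      exact hn (by simpa using (of_decide_eq_true hk) ▸ hmemS m hm)
    simp [hs, this]
  -- the monomial attached to a key
  set μ : ℕ → R := fun n => a ^ (n % M) * b ^ (n / M) * x ^ ((W - 4 * (n % M) - 6 * (n / M)) / 2)
    with hμ
  have hmono : ∀ m ∈ p, Mono.eval a b x m = (m.c : R) * μ (key m) := by
    intro m hm
    have hi : key m % M = m.i := by
      rw [hkey]; simp only; rw [Nat.add_mul_mod_self_left, Nat.mod_eq_of_lt (hI m hm)]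
    have hj : key m / M = m.j := by
      rw [hkey]; simp only; rw [Nat.add_mul_div_left _ _ hM, Nat.div_eq_of_lt (hI m hm), zero_add]
    have hk : (W - 4 * m.i - 6 * m.j) / 2 = m.k := by
      have := hW m hm
      simp only [Mono.wt] at this
      omega
    rw [hμ]; simp only; rw [hi, hj, hk, Mono.eval]
    ring
  -- `eval p = Σ_{n ∈ S} s n · μ n`
  have heval : eval a b x p = ∑ n ∈ S, (s n : R) * μ n := by
    rw [eval, list_sum_map_eq_sum_fiber key (Mono.eval a b x) S p hmemS]
    refine Finset.sum_congr rfl fun n _ => ?_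
    have hfib : ∀ m ∈ p.filter (fun m => key m = n), key m = n := fun m hm => by
      simpa using (List.mem_filter.mp hm).2
    have hsub : ∀ m ∈ p.filter (fun m => key m = n), m ∈ p := fun m hm => (List.mem_filter.mp hm).1
    rw [show ((p.filter fun m => key m = n).map (Mono.eval a b x)) =
        ((p.filter fun m => key m = n).map fun m => (m.c : R) * μ (key m)) from
      List.map_congr_left fun m hm => hmono m (hsub m hm)]
    rw [sum_fiber_mul key μ n _ hfib]
  -- `evalK p = Σ_{n ∈ S} s n · T^n = Σ_{n < N} s n T^n`
  have hevalK : evalK T M p = ∑ n ∈ Finset.range N, s n * (T : ℤ) ^ n := by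
    rw [evalK, list_sum_map_eq_sum_fiber key _ S p hmemS]
    have e1 : ∑ n ∈ S, ((p.filter fun m => key m = n).map
        fun m : Mono => m.c * ((T ^ (m.i + M * m.j) : ℕ) : ℤ)).sum = ∑ n ∈ S, s n * (T : ℤ) ^ n := by
      refine Finset.sum_congr rfl fun n _ => ?_
      have hfib : ∀ m ∈ p.filter (fun m => key m = n), key m = n := fun m hm => by
        simpa using (List.mem_filter.mp hm).2
      rw [show ((p.filter fun m => key m = n).map fun m : Mono => m.c * ((T ^ (m.i + M * m.j) : ℕ) : ℤ)) =
          ((p.filter fun m => key m = n).map fun m : Mono =>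
            (Int.cast m.c : ℤ) * (fun n => ((T : ℤ)) ^ n) (key m))
          from List.map_congr_left fun m _ => by simp only [hkey, Int.cast_id]; push_cast; ring]
      rw [sum_fiber_mul key (fun n => (T : ℤ) ^ n) n _ hfib, Int.cast_id]
    rw [e1]
    refine Finset.sum_subset (fun n hn => Finset.mem_range.mpr (hN n hn)) ?_
    intro n _ hn
    rw [hs_out n hn, zero_mul]
  have hzero : ∀ n < N, s n = 0 :=
    digits_eq_zero (Nat.pos_of_ne_zero (by rintro rfl; exact Nat.not_lt_zero _ hl)) N s hs_abs
      (hevalK ▸ hK)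
  rw [heval]
  refine Finset.sum_eq_zero fun n hn => ?_
  rw [hzero n (hN n hn), Int.cast_zero, zero_mul]

/-! ### The data: homogeneity, exponent bounds, norms, and the two kernel certificates -/

/-- `U7` is homogeneous of weight `48` with `a`-exponents `≤ 12`; `l1 U7 = 327255176`. [folklore] -/
theorem U7_data : Homog 48 U7 ∧ IBd 12 U7 ∧ l1 U7 = 327255176 := by
  refine ⟨?_, ?_, ?_⟩ <;> decide +kernel

/-- `V7` is homogeneous of weight `48` with `a`-exponents `≤ 12`; `l1 V7 = 60876648`. [folklore] -/
theorem V7_data : Homog 48 V7 ∧ IBd 12 V7 ∧ l1 V7 = 60876648 := by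
  refine ⟨?_, ?_, ?_⟩ <;> decide +kernel

/-- `U7b` is homogeneous of weight `48` with `a`-exponents `≤ 12`; `l1 U7b = 429964484`. [folklore] -/
theorem U7b_data : Homog 48 U7b ∧ IBd 12 U7b ∧ l1 U7b = 429964484 := by
  refine ⟨?_, ?_, ?_⟩ <;> decide +kernel

/-- `V7b` is homogeneous of weight `48` with `a`-exponents `≤ 12`; `l1 V7b = 52660736`. [folklore] -/
theorem V7b_data : Homog 48 V7b ∧ IBd 12 V7b ∧ l1 V7b = 52660736 := by
  refine ⟨?_, ?_, ?_⟩ <;> decide +kernel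

/-- `Φ₇` is homogeneous of weight `48` with `a`-exponents `≤ 12`; `l1 Phi7 = 51453588`. [folklore] -/
theorem Phi7_data : Homog 48 Phi7 ∧ IBd 12 Phi7 ∧ l1 Phi7 = 51453588 := by
  refine ⟨?_, ?_, ?_⟩ <;> decide +kernel

/-- `q7` is homogeneous of weight `348` with `a`-exponents `≤ 87`; its `l1`. [folklore] -/
theorem q7_data : Homog 348 q7 ∧ IBd 87 q7 ∧
    l1 q7 = 256295120068017985205144774232060439772125099835921687012838 := by
  refine ⟨?_, ?_, ?_⟩ <;> decide +kernel

/-- `q7b` is homogeneous of weight `348` with `a`-exponents `≤ 87`; its `l1`. [folklore] -/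
theorem q7b_data : Homog 348 q7b ∧ IBd 87 q7b ∧
    l1 q7b = 14600439827150717861367087190281952418584620174546635022061272 := by
  refine ⟨?_, ?_, ?_⟩ <;> decide +kernel

/-- `va`, `vb`: weights `4`, `6`, `a`-exponents `≤ 1`, `≤ 0`. [folklore] -/
theorem va_vb_data : Homog 4 va ∧ IBd 1 va ∧ Homog 6 vb ∧ IBd 0 vb := by
  refine ⟨?_, ?_, ?_, ?_⟩ <;> decide

/-- Homogeneity (weight `396`) of the raw difference `Γ₇ʳᵃʷ(U, V) − q ·ʳᵃʷ Φ₇` for weight-`48` data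
`U, V` and a weight-`348` cofactor `q`. [folklore] -/
theorem homog_diff {U V q : SPoly} (hU : Homog 48 U) (hV : Homog 48 V) (hq : Homog 348 q) :
    Homog 396 (sub (gamma7OfRaw U V) (mulRaw q Phi7)) := by
  have ha3 : Homog 12 (powRaw va 3) := by simpa using va_vb_data.1.powRaw 3
  have hb2 : Homog 12 (powRaw vb 2) := by simpa using va_vb_data.2.2.1.powRaw 2
  have hV7 : Homog 336 (powRaw V 7) := by simpa using hV.powRaw 7
  have hUU : Homog 96 (mulRaw U U) := hU.mulRaw hU
  have hUV : Homog 96 (mulRaw U V) := hU.mulRaw hV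
  have hVV : Homog 96 (mulRaw V V) := hV.mulRaw hV
  have hQ1 : Homog 96 (add (add (mulRaw U U) (smul 13 (mulRaw U V))) (smul 49 (mulRaw V V))) :=
    (hUU.append (hUV.smul 13)).append (hVV.smul 49)
  have hQ2 : Homog 96 (add (add (mulRaw U U) (smul 5 (mulRaw U V))) (mulRaw V V)) :=
    (hUU.append (hUV.smul 5)).append hVV
  have hQ23 : Homog 288 (powRaw (add (add (mulRaw U U) (smul 5 (mulRaw U V))) (mulRaw V V)) 3) := by
    simpa using hQ2.powRaw 3
  have h1 : Homog 396 (smul 6912 (mulRaw (powRaw va 3) (mulRaw U (powRaw V 7)))) :=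
    (ha3.mulRaw (hU.mulRaw hV7)).smul 6912
  have h2 : Homog 396 (mulRaw (add (smul 4 (powRaw va 3)) (smul 27 (powRaw vb 2)))
      (mulRaw (add (add (mulRaw U U) (smul 13 (mulRaw U V))) (smul 49 (mulRaw V V)))
        (powRaw (add (add (mulRaw U U) (smul 5 (mulRaw U V))) (mulRaw V V)) 3))) :=
    ((ha3.smul 4).append (hb2.smul 27)).mulRaw (hQ1.mulRaw hQ23)
  have h3 : Homog 396 (mulRaw q Phi7) := hq.mulRaw Phi7_data.1
  exact (h1.append (h2.smul _)).append (h3.smul _)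

/-- `a`-exponent bound (`≤ 99`) of the raw difference. [folklore] -/
theorem ibd_diff {U V q : SPoly} (hU : IBd 12 U) (hV : IBd 12 V) (hq : IBd 87 q) :
    IBd 99 (sub (gamma7OfRaw U V) (mulRaw q Phi7)) := by
  have ha3 : IBd 3 (powRaw va 3) := by simpa using va_vb_data.2.1.powRaw 3
  have hb2 : IBd 0 (powRaw vb 2) := by simpa using va_vb_data.2.2.2.powRaw 2
  have hV7 : IBd 84 (powRaw V 7) := by simpa using hV.powRaw 7
  have hUU : IBd 24 (mulRaw U U) := hU.mulRaw hU
  have hUV : IBd 24 (mulRaw U V) := hU.mulRaw hV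
  have hVV : IBd 24 (mulRaw V V) := hV.mulRaw hV
  have hQ1 : IBd 24 (add (add (mulRaw U U) (smul 13 (mulRaw U V))) (smul 49 (mulRaw V V))) :=
    (hUU.append (hUV.smul 13)).append (hVV.smul 49)
  have hQ2 : IBd 24 (add (add (mulRaw U U) (smul 5 (mulRaw U V))) (mulRaw V V)) :=
    (hUU.append (hUV.smul 5)).append hVV
  have hQ23 : IBd 72 (powRaw (add (add (mulRaw U U) (smul 5 (mulRaw U V))) (mulRaw V V)) 3) := by
    simpa using hQ2.powRaw 3
  have h1 : IBd 99 (smul 6912 (mulRaw (powRaw va 3) (mulRaw U (powRaw V 7)))) :=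
    (ha3.mulRaw (hU.mulRaw hV7)).smul 6912
  have h2 : IBd 99 (mulRaw (add (smul 4 (powRaw va 3)) (smul 27 (powRaw vb 2)))
      (mulRaw (add (add (mulRaw U U) (smul 13 (mulRaw U V))) (smul 49 (mulRaw V V)))
        (powRaw (add (add (mulRaw U U) (smul 5 (mulRaw U V))) (mulRaw V V)) 3))) :=
    ((ha3.smul 4).append ((hb2.smul 27).mono (by norm_num))).mulRaw (hQ1.mulRaw hQ23)
  have h3 : IBd 99 (mulRaw q Phi7) := hq.mulRaw Phi7_data.2.1
  exact (h1.append (h2.smul _)).append (h3.smul _)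

/-- `l1` of the raw difference, as a formula in the `l1` of the data. [folklore] -/
theorem l1_diff (U V q : SPoly) :
    l1 (sub (gamma7OfRaw U V) (mulRaw q Phi7)) =
      6912 * (l1 U * l1 V ^ 7) +
        (4 + 27) * ((l1 U * l1 U + 13 * (l1 U * l1 V) + 49 * (l1 V * l1 V)) *
          (l1 U * l1 U + 5 * (l1 U * l1 V) + l1 V * l1 V) ^ 3) + l1 q * l1 Phi7 := by
  simp only [gamma7OfRaw, l1_sub, l1_smul, l1_mulRaw, l1_powRaw, l1_add, l1_va, l1_vb]
  norm_num

/-- The base and stride of the Kronecker evaluation. [folklore] -/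
theorem kron_T_pos : 0 < (2 : ℕ) ^ 300 := by positivity

/-- `evalK` is additive over the raw difference shape: the value of `Γ₇ʳᵃʷ(U,V) − q·Φ₇` at
`(T, T^M, 1)` in terms of the values of `U, V, q, Φ₇`. [folklore] -/
theorem evalK_diff (T M : ℕ) (U V q : SPoly) :
    evalK T M (sub (gamma7OfRaw U V) (mulRaw q Phi7)) =
      6912 * (T : ℤ) ^ 3 * evalK T M U * evalK T M V ^ 7 -
          (4 * (T : ℤ) ^ 3 + 27 * ((T : ℤ) ^ M) ^ 2) *
            ((evalK T M U ^ 2 + 13 * (evalK T M U * evalK T M V) + 49 * evalK T M V ^ 2) *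
              (evalK T M U ^ 2 + 5 * (evalK T M U * evalK T M V) + evalK T M V ^ 2) ^ 3) -
        evalK T M q * evalK T M Phi7 := by
  simp only [← eval_kronecker]
  rw [eval_sub, eval_gamma7OfRaw, eval_mulRaw]

/-- **Kernel certificate 1**: the Kronecker value of `Γ₇ʳᵃʷ(U7, V7) − q7 ·ʳᵃʷ Φ₇` at `T = 2^300`,
`M = 128` vanishes (an identity between explicit integers; `decide +kernel`, accelerated `Nat.pow`).
[folklore] -/
theorem gamma7_evalK_cert :
    6912 * ((2 : ℕ) ^ 300 : ℤ) ^ 3 * evalK (2 ^ 300) 128 U7 * evalK (2 ^ 300) 128 V7 ^ 7 -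
          (4 * ((2 : ℕ) ^ 300 : ℤ) ^ 3 + 27 * (((2 : ℕ) ^ 300 : ℤ) ^ 128) ^ 2) *
            ((evalK (2 ^ 300) 128 U7 ^ 2 + 13 * (evalK (2 ^ 300) 128 U7 * evalK (2 ^ 300) 128 V7) +
                49 * evalK (2 ^ 300) 128 V7 ^ 2) *
              (evalK (2 ^ 300) 128 U7 ^ 2 + 5 * (evalK (2 ^ 300) 128 U7 * evalK (2 ^ 300) 128 V7) +
                evalK (2 ^ 300) 128 V7 ^ 2) ^ 3) -
        evalK (2 ^ 300) 128 q7 * evalK (2 ^ 300) 128 Phi7 = 0 := by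
  decide +kernel

/-- **Kernel certificate 2**: the same for `U7b, V7b, q7b`. [folklore] -/
theorem gamma7b_evalK_cert :
    6912 * ((2 : ℕ) ^ 300 : ℤ) ^ 3 * evalK (2 ^ 300) 128 U7b * evalK (2 ^ 300) 128 V7b ^ 7 -
          (4 * ((2 : ℕ) ^ 300 : ℤ) ^ 3 + 27 * (((2 : ℕ) ^ 300 : ℤ) ^ 128) ^ 2) *
            ((evalK (2 ^ 300) 128 U7b ^ 2 + 13 * (evalK (2 ^ 300) 128 U7b * evalK (2 ^ 300) 128 V7b) +
                49 * evalK (2 ^ 300) 128 V7b ^ 2) *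
              (evalK (2 ^ 300) 128 U7b ^ 2 + 5 * (evalK (2 ^ 300) 128 U7b * evalK (2 ^ 300) 128 V7b) +
                evalK (2 ^ 300) 128 V7b ^ 2) ^ 3) -
        evalK (2 ^ 300) 128 q7b * evalK (2 ^ 300) 128 Phi7 = 0 := by
  decide +kernel

/-- **Certificate 1, kernel-checked**: `Γ₇(U7, V7)` and `q7 · Φ₇` have equal values everywhere —
exactly the statement `PolyCert.eval_eq_of_isZero_sub a b x gamma7_cert`, now without
`Lean.ofReduceBool`. [folklore] -/
theorem eval_gamma7Of_eq_kernel (a b x : R) :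
    eval a b x (gamma7Of U7 V7) = eval a b x (mul q7 Phi7) := by
  have h := eval_eq_zero_of_evalK_eq_zero (R := R) (W := 396) (M := 128) (T := 2 ^ 300)
    (by norm_num) (homog_diff U7_data.1 V7_data.1 q7_data.1)
    (fun m hm => Nat.lt_of_le_of_lt (ibd_diff U7_data.2.1 V7_data.2.1 q7_data.2.1 m hm) (by norm_num))
    (by rw [l1_diff, U7_data.2.2, V7_data.2.2, q7_data.2.2, Phi7_data.2.2]; decide +kernel)
    (by rw [evalK_diff]; exact_mod_cast gamma7_evalK_cert) a b x
  rw [eval_sub, eval_gamma7OfRaw, eval_mulRaw, sub_eq_zero] at h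
  rw [eval_gamma7Of, eval_mul]
  exact h

/-- **Certificate 2, kernel-checked**: `Γ₇(U7b, V7b)` and `q7b · Φ₇` have equal values everywhere
(the statement `PolyCert.eval_eq_of_isZero_sub a b x gamma7b_cert` without `Lean.ofReduceBool`).
[folklore] -/
theorem eval_gamma7bOf_eq_kernel (a b x : R) :
    eval a b x (gamma7Of U7b V7b) = eval a b x (mul q7b Phi7) := by
  have h := eval_eq_zero_of_evalK_eq_zero (R := R) (W := 396) (M := 128) (T := 2 ^ 300)
    (by norm_num) (homog_diff U7b_data.1 V7b_data.1 q7b_data.1)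
    (fun m hm => Nat.lt_of_le_of_lt (ibd_diff U7b_data.2.1 V7b_data.2.1 q7b_data.2.1 m hm)
      (by norm_num))
    (by rw [l1_diff, U7b_data.2.2, V7b_data.2.2, q7b_data.2.2, Phi7_data.2.2]; decide +kernel)
    (by rw [evalK_diff]; exact_mod_cast gamma7b_evalK_cert) a b x
  rw [eval_sub, eval_gamma7OfRaw, eval_mulRaw, sub_eq_zero] at h
  rw [eval_gamma7Of, eval_mul]
  exact h

end Literature.NumberTheory.EllipticCurves.PolyCert
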